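import Summits.Ventures.PercRepro.NullityTwoDual
import Summits.Ventures.PercRepro.RankTwoHallDegree
import Summits.Ventures.PercRepro.C025ProfileGenHall
import Summits.Ventures.PercRepro.C025ProfileFourCapE

/-!
# PercRepro — THE HALL FORM (C-033, `H⁺`) OF THE ROW `q = 2` FOR EVERY FINITE MATROID, EVERY LEVEL, EVERY FAMILY
(p10, gen 5; `proofs/P10-HALLROW.md` §8 — the assembly)

`RankTwoHall` — Hall's condition for disjointness on the independent pairs of a rank-2 matroid of cogirth `≥ 3`,
the single residual of the Hall row for `u ≥ 5` (`NullityTwoDual`) — is a theorem (`RankTwoHallDegree`: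
the degree-only Hall lemma).  With night-3's unconditional rows `(2, 3)` and `(2, 4)` this closes the row `q = 2`
of the Hall form at every level:

  **`hallIneq_two_all (M) [M.Finite] (u) (hu : 2 < u) : HallIneq M 2 u`** — for every finite matroid `M`, every
  level `u > 2` and every family `𝒜` of rank-2 sets, `Σ_{B ∈ 𝒜} price(B) ≤ #{S : ρ(S) = u, S ⊇ some B ∈ 𝒜}`.

This is the SECOND route to the row (through the nullity split of `NullityHall` / `NullityTwoDual` and the
rank-2 dual); the route of record is `CoIndepPairsDegree.hallIneq_two_all_direct`, which applies the degree-only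
Hall lemma to the co-independent pairs directly.  Both prove the same statement.

* `rankTwoHall` — `RankTwoHall α`;
* `hallIneq_two_of_five_le` — the row for `u ≥ 5`;
* **`hallIneq_two_all`** — the row for every `u > 2`.
-/

open scoped Matroid

namespace PercRepro.Cogirth

open Finset ThmH Skew Shadow Profile HallDisjoint

variable {α : Type} [DecidableEq α]

/-- **`RankTwoHall` holds**: Hall's condition for disjointness on the independent pairs of every finite rank-2
matroid of cogirth `≥ 3` (the size hypothesis is not needed). -/
theorem rankTwoHall : RankTwoHall α :=
  fun _ _ hR hc _ _ h𝒜 => hall_indepSets_two_of_cogirth hR hc h𝒜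

/-- **The Hall row `(H⁺_{2,u})` for every finite matroid and every `u ≥ 5`.** -/
theorem hallIneq_two_of_five_le {u : ℕ} (hu : 5 ≤ u) (M : Matroid α) [M.Finite] : HallIneq M 2 u :=
  hallIneq_two_all_of_rankTwoHall rankTwoHall hu M

/-- **THE ROW `q = 2` OF THE HALL FORM (C-033) FOR EVERY FINITE MATROID, EVERY LEVEL `u > 2` AND EVERY FAMILY
OF RANK-2 SETS.** -/
theorem hallIneq_two_all (M : Matroid α) [M.Finite] (u : ℕ) (hu : 2 < u) : HallIneq M 2 u := by
  rcases Nat.lt_or_ge u 5 with h5 | h5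
  · interval_cases u
    · exact hallIneq_two_three M
    · exact hallIneq_two_four M
  · exact hallIneq_two_of_five_le h5 M

end PercRepro.Cogirth
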